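import Summits.BirchSwinnertonDyer.BirchSwinnertonDyer.Theorems.ClassRecordThreeRegCertKernel
import Summits.BirchSwinnertonDyer.BirchSwinnertonDyer.Theorems.ClassRecordThreeRegCertKernelO2Height
import Summits.BirchSwinnertonDyer.BirchSwinnertonDyer.Theorems.ClassRecordThreeRegCertKernelO3Deep
import HarnessLib

/-!
# Route `ClassRecordThree`, crux `SchneiderAtThree` (item 19106): the THIRD-ORDER kernel evaluator at a certificate
# point of depth EXACTLY `2` (`v₃(e(Q)) = 2`, `v₃(h(Q)) ≤ 3`) — `h mod 81` from `(a, b, e', a₁, a₂, γ)` and one residue `u`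
# (cell `bsd-stepL`, seat `bsd-stepL-reg3-eng` g3; `--supports stmt-BirchSwinnertonDyer-19106`)

HONEST FRAMING: BSD is not proved by any of this; nothing here closes the crux; Schneider's conjecture (barrier
`PAdicHeightNondegeneracy`) is asserted NOWHERE; every application is ONE curve. The gap between `…O3Deep` (`K ≥ 3`,
where `C²σ² ≡ z²(1 + a₁z)` to relative precision `3⁻⁴`) and `…O3Cert` (`K = 1`): at `K = 2` (`z = −ae/b`,
`‖z‖ = 3⁻²`, `w = L²/C²`, `‖w‖ = 3⁻⁴`) two more terms survive to relative precision `3⁻⁴` — the cubic term of the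
formal logarithm and the quadratic term of `ch`, through which the scale `C² ≡ γ (mod 9)` re-enters:
`C²σ² ≡ L₀² + z⁴/(12γ) (mod 3⁻⁸)`, `L₀ = z + a₁z²/2 + (a₁² + a₂)z³/3` (§1: `‖log_Ŵ(z) − L₀‖ ≤ ‖z‖⁴` on `‖z‖ ≤ 3⁻²`;
§2: the sigma product `≡ 1`, `ch w − 1 ≡ w/2 + w²/24`). With `M = 2b² − 9a₁(ae')b + 54(a₁² + a₂)(ae')²` this is
`81·U`, `U = (γ(ae')²M² + 27(ae')⁴b²)/(4γb⁶)`, pinned by `81 ∣ γ(ae')²M² + 27(ae')⁴b² − 4γub⁶`; then the Iwasawa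
logarithms of `…O3Deep` §1 give `h ≡ ½[(E − E²/2 + E³/3) − (V − V²/2 + V³/3)] (mod 81)`, `E = e'⁴ − 1`, `V = u² − 1`,
CERTIFICATE **`3⁵ ∤ 6E − 3E² + 2E³ − 6V + 3V² − 2V³`** (§2 `heightFourOneCoord_ne_zero_of_midCertO3`, §3 the bundled
checker `certNonsplit_of_midCertO3`). Validated offline on all 169 depth-2 rows of kit j249075 (`h mod 81` reproduced).
Theorems only (0 defs, 0 facts). References: [SteinWuthrich2013] §4.2; [SilvermanAEC2009] IV.6; [Iwasawa1972PadicL] §4.4.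
-/

open scoped Classical
open PowerSeries WeierstrassCurve Literature.NumberTheory.EllipticCurves
  Literature.NumberTheory.EllipticCurves.Rank1Residual
  Literature.NumberTheory.EllipticCurves.SteinWuthrich2013
  Summit.BirchSwinnertonDyer.Rank1Residual
  Summit.BirchSwinnertonDyer.Rank1Residual.X11b
  Summit.BirchSwinnertonDyer.Rank1Residual.X11b.RegMult.Rung62310y1

namespace Summit.BirchSwinnertonDyer.Rank1Residual.X11b.RegMult.KernelCert

/-! ### §0 Plumbing -/

/-- Ultrametric inequality for differences. [folklore] -/
private theorem norm_sub_le_max₁₀ (a b : ℚ_[3]) : ‖a - b‖ ≤ max ‖a‖ ‖b‖ := by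
  rw [sub_eq_add_neg, ← norm_neg b]; exact IsUltrametricDist.norm_add_le_max a (-b)

/-- `‖(2 : ℚ₃)⁻¹‖ = 1`. [folklore] -/
private theorem norm_inv_two₁₀ : ‖(2 : ℚ_[3])⁻¹‖ = 1 := by
  rw [norm_inv, show (2 : ℚ_[3]) = ((2 : ℤ) : ℚ_[3]) by norm_cast, norm_intCast_eq_one_of_not_dvd (by decide),
    inv_one]

/-- `‖(3 : ℚ₃)⁻¹‖ = 3`. [folklore] -/
private theorem norm_inv_three₁₀ : ‖(3 : ℚ_[3])⁻¹‖ = 3 := by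
  rw [norm_inv, show (3 : ℚ_[3]) = ((3 : ℕ) : ℚ_[3]) by norm_cast, Padic.norm_p]; norm_num

/-- `‖(12 : ℚ₃)⁻¹‖ = 3`. [folklore] -/
private theorem norm_inv_twelve₁₀ : ‖(12 : ℚ_[3])⁻¹‖ = 3 := by
  rw [show (12 : ℚ_[3]) = 4 * 3 by norm_num, mul_inv, norm_mul, norm_inv_three₁₀, norm_inv,
    show (4 : ℚ_[3]) = ((4 : ℤ) : ℚ_[3]) by norm_cast, norm_intCast_eq_one_of_not_dvd (by decide)]; norm_num

/-- `n + 5 ≤ 9^{n+1}`. [folklore] -/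
private theorem add_five_le (n : ℕ) : n + 5 ≤ 9 ^ (n + 1) := by
  induction n with
  | zero => norm_num
  | succ k ih =>
    have h : 9 ^ (k + 1 + 1) = 9 * 9 ^ (k + 1) := by ring
    omega

/-! ### §1 The formal logarithm to third order on `‖z‖ ≤ 3⁻²` -/

section Padic

variable (V : WeierstrassCurve ℚ_[3]) [V.IsIntegral ℤ_[3]]

/-- Each term of degree `n + 4` of `log_Ŵ(z)` has norm `≤ ‖z‖⁴` for `‖z‖₃ ≤ 3⁻²` (`‖1/4‖ = 1`, `m ≤ 9^{m−4}` for
`m ≥ 5`). [cite: SilvermanAEC2009, IV.6.3] -/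
private theorem norm_formalLog_term_le_quart {z : ℚ_[3]} (hz : ‖z‖ ≤ 1 / 9) (n : ℕ) :
    ‖coeff (n + 4) V.formalLog * z ^ (n + 4)‖ ≤ ‖z‖ ^ 4 := by
  rw [norm_mul, norm_pow]
  have hc := norm_coeff_formalLog_le_norm_inv V (n + 2)
  rw [show n + 2 + 2 = n + 4 by ring] at hc
  cases n with
  | zero =>
    have h4 : ‖(((0 + 4 : ℕ) : ℚ_[3]))⁻¹‖ = 1 := by
      rw [show ((0 + 4 : ℕ) : ℚ_[3]) = ((4 : ℤ) : ℚ_[3]) by norm_num, norm_inv,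
        norm_intCast_eq_one_of_not_dvd (by decide), inv_one]
    calc ‖coeff (0 + 4) V.formalLog‖ * ‖z‖ ^ (0 + 4) ≤ 1 * ‖z‖ ^ (0 + 4) := by gcongr; exact hc.trans h4.le
      _ = ‖z‖ ^ 4 := by ring
  | succ k =>
    have hm : ‖(((k + 1 + 4 : ℕ) : ℚ_[3]))⁻¹‖ ≤ ((k + 1 + 4 : ℕ) : ℝ) := padic_norm_inv_natCast_le _
    have hpow : ((k + 1 + 4 : ℕ) : ℝ) ≤ (9 : ℝ) ^ (k + 1) := by
      have h := add_five_le k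
      rw [show k + 1 + 4 = k + 5 by ring]; exact_mod_cast h
    calc ‖coeff (k + 1 + 4) V.formalLog‖ * ‖z‖ ^ (k + 1 + 4)
        ≤ (9 : ℝ) ^ (k + 1) * ‖z‖ ^ (k + 1 + 4) := by gcongr; exact hc.trans (hm.trans hpow)
      _ = ‖z‖ ^ 4 * ((9 : ℝ) ^ (k + 1) * ‖z‖ ^ (k + 1)) := by ring
      _ ≤ ‖z‖ ^ 4 * ((9 : ℝ) ^ (k + 1) * (1 / 9 : ℝ) ^ (k + 1)) := by gcongr
      _ = ‖z‖ ^ 4 := by rw [← mul_pow]; norm_num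

/-- **`log_Ŵ(z) = z + (a₁/2)z² + ((a₁² + a₂)/3)z³ + O(‖z‖⁴)` on `‖z‖₃ ≤ 3⁻²`** for a `3`-integral equation over `ℚ₃`.
[cite: SilvermanAEC2009, IV.6.4] -/
theorem norm_padicFormalLog_sub_cubic_le_deep {z : ℚ_[3]} (hz : ‖z‖ ≤ 1 / 9) :
    ‖V.padicFormalLog z - (z + (2 : ℚ_[3])⁻¹ * V.a₁ * z ^ 2 + (3 : ℚ_[3])⁻¹ * (V.a₁ ^ 2 + V.a₂) * z ^ 3)‖ ≤
      ‖z‖ ^ 4 := by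
  have hs := V.summable_formalLog_of_isIntegral z (hz.trans_lt (by norm_num))
  have hsplit := hs.sum_add_tsum_nat_add 4
  have h0 : coeff 0 V.formalLog = 0 := by rw [coeff_zero_eq_constantCoeff]; exact V.constantCoeff_formalLog
  have h2 : coeff 2 V.formalLog = (2 : ℚ_[3])⁻¹ * V.a₁ := by
    rw [(coeff_two_formalLog V), eq_ratCast]; push_cast; ring
  have h3 : coeff 3 V.formalLog = (3 : ℚ_[3])⁻¹ * (V.a₁ ^ 2 + V.a₂) := by
    rw [(coeff_three_formalLog V), eq_ratCast]; push_cast; ring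
  have hfour : ∑ i ∈ Finset.range 4, coeff i V.formalLog * z ^ i =
      z + (2 : ℚ_[3])⁻¹ * V.a₁ * z ^ 2 + (3 : ℚ_[3])⁻¹ * (V.a₁ ^ 2 + V.a₂) * z ^ 3 := by
    simp only [Finset.sum_range_succ, Finset.sum_range_zero, h0, V.coeff_one_formalLog, h2, h3]
    ring
  rw [WeierstrassCurve.padicFormalLog, ← hsplit, hfour, add_sub_cancel_left]
  exact IsUltrametricDist.norm_tsum_le_of_forall_le_of_nonneg (by positivity) fun n ↦
    norm_formalLog_term_le_quart V hz n

end Padic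

/-! ### §2 Assembly at depth exactly `2`, third order -/

/-- **The third-order DEPTH-TWO REG3CERT kernel certificate (`v₃(e(Q)) = 2`, `v₃(h(Q)) ≤ 3`).** `W/ℚ` globally minimal,
`a₁, a₂, c₄, c₆` read in `ℚ₃`, `3 ∤ c₆`, `9 ∣ c₄ + γc₆`, `3 ∤ γ`; `(x, y) = (a/e², b/e³)`, `e = 9e'`, `3 ∤ e'`, `3 ∤ b`,
`gcd(a, e) = 1`; an integer `u` with `81 ∣ γ(ae')²M² + 27(ae')⁴b² − 4γub⁶`, `M = 2b² − 9a₁(ae')b + 54(a₁² + a₂)(ae')²`,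
`3 ∤ u`, `3 ∣ u² − 1`. If **`3⁵ ∤ 6E − 3E² + 2E³ − 6V + 3V² − 2V³`** (`E = e'⁴ − 1`, `V = u² − 1`), then
`heightFourOneCoord W 3 q x y ≠ 0` for EVERY `‖q‖₃ < 1`: `C²σ² ≡ L₀² + z⁴/(12γ) = 81·U` to precision `3⁻⁸` (§1, the
cubic `ch` lemma, the sigma product `≡ 1 (mod 3⁻⁵)`, `‖C² − γ‖ ≤ 3⁻²`), and the two Iwasawa logarithms to three terms.
[cite: SteinWuthrich2013, §4.2] [cite: Iwasawa1972PadicL, §4.4] -/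
theorem heightFourOneCoord_ne_zero_of_midCertO3 (W : WeierstrassCurve ℚ) [W.IsGloballyMinimal]
    {a₁ a₂ c4 c6 γ : ℤ} (ha1 : (W.baseChange ℚ_[3]).a₁ = a₁) (ha2 : (W.baseChange ℚ_[3]).a₂ = a₂)
    (hc4 : (W.baseChange ℚ_[3]).c₄ = c4) (hc6 : (W.baseChange ℚ_[3]).c₆ = c6) (h3c6 : ¬ (3 : ℤ) ∣ c6)
    (hγ : (9 : ℤ) ∣ c4 + γ * c6) (h3γ : ¬ (3 : ℤ) ∣ γ)
    {a b : ℤ} {e' : ℕ} (h3e' : ¬ (3 : ℤ) ∣ e') (h3b : ¬ (3 : ℤ) ∣ b) (hcop : Nat.Coprime a.natAbs (3 ^ 2 * e'))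
    {x y : ℚ} (hx : x = a / ((3 ^ 2 * e' : ℕ) : ℚ) ^ 2) (hy : y = b / ((3 ^ 2 * e' : ℕ) : ℚ) ^ 3)
    {u : ℤ} (hu : (81 : ℤ) ∣ γ * (a * e') ^ 2 * (2 * b ^ 2 - 9 * a₁ * (a * e') * b + 54 * (a₁ ^ 2 + a₂) * (a * e') ^ 2) ^ 2 +
      27 * (a * e') ^ 4 * b ^ 2 - 4 * γ * u * b ^ 6) (h3u : ¬ (3 : ℤ) ∣ u) (h3u2 : (3 : ℤ) ∣ u ^ 2 - 1)
    (hcert : ¬ (243 : ℤ) ∣ 6 * ((e' : ℤ) ^ 4 - 1) - 3 * ((e' : ℤ) ^ 4 - 1) ^ 2 + 2 * ((e' : ℤ) ^ 4 - 1) ^ 3 -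
      6 * (u ^ 2 - 1) + 3 * (u ^ 2 - 1) ^ 2 - 2 * (u ^ 2 - 1) ^ 3) {q : ℚ_[3]} (hq : ‖q‖ < 1) :
    heightFourOneCoord W 3 q x y ≠ 0 := by
  have hq3 : ‖q‖ ≤ 1 / 3 := norm_le_third_of_norm_lt_one hq
  have he'0 : e' ≠ 0 := by rintro rfl; exact h3e' (by simp)
  have he0 : (3 ^ 2 * e' : ℕ) ≠ 0 := by positivity
  have hb0 : b ≠ 0 := by rintro rfl; exact h3b (dvd_zero 3)
  have hγ0 : γ ≠ 0 := by rintro rfl; exact h3γ (dvd_zero 3)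
  have h3a : ¬ (3 : ℤ) ∣ a := by
    intro h
    have h1 : 3 ∣ a.natAbs := Int.natCast_dvd.mp h
    have h3 : 3 ∣ Nat.gcd a.natAbs (3 ^ 2 * e') := Nat.dvd_gcd h1 (dvd_mul_of_dvd_left (dvd_pow_self 3 (by omega)) e')
    rw [hcop] at h3; omega
  have han : ‖(a : ℚ_[3])‖ = 1 := norm_intCast_eq_one_of_not_dvd h3a
  have hbn : ‖(b : ℚ_[3])‖ = 1 := norm_intCast_eq_one_of_not_dvd h3b
  have he'n : ‖(e' : ℚ_[3])‖ = 1 := by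
    have := norm_intCast_eq_one_of_not_dvd h3e'; push_cast at this; exact this
  have hγn : ‖(γ : ℚ_[3])‖ = 1 := norm_intCast_eq_one_of_not_dvd h3γ
  have ha1n : ‖(a₁ : ℚ_[3])‖ ≤ 1 := Padic.norm_int_le_one _
  have ha2n : ‖((a₁ : ℚ_[3]) ^ 2 + a₂)‖ ≤ 1 := by
    rw [show (a₁ : ℚ_[3]) ^ 2 + a₂ = (((a₁ ^ 2 + a₂ : ℤ)) : ℚ_[3]) by push_cast; ring]; exact Padic.norm_int_le_one _
  have hb0' : (b : ℚ_[3]) ≠ 0 := by exact_mod_cast hb0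
  have hγ0' : (γ : ℚ_[3]) ≠ 0 := by exact_mod_cast hγ0
  have h2n : ‖(2 : ℚ_[3])‖ = 1 := by
    rw [show (2 : ℚ_[3]) = ((2 : ℤ) : ℚ_[3]) by norm_cast]; exact norm_intCast_eq_one_of_not_dvd (by decide)
  set P : ℚ_[3] := (3 : ℚ_[3]) ^ (2 * 2) with hP
  have hPn : ‖P‖ = 1 / 81 := by
    rw [hP, norm_pow, show (3 : ℚ_[3]) = ((3 : ℕ) : ℚ_[3]) by norm_cast, Padic.norm_p]; norm_num
  set z : ℚ_[3] := -((a : ℚ_[3]) * ((3 ^ 2 * e' : ℕ) : ℚ_[3])) / (b : ℚ_[3]) with hz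
  have hρ : ‖z‖ = 1 / 9 := by
    rw [hz, norm_div, norm_neg, norm_mul, han, hbn, one_mul, div_one]
    push_cast
    rw [norm_mul, he'n, mul_one, show (9 : ℚ_[3]) = ((3 : ℕ) : ℚ_[3]) ^ 2 by norm_num, norm_pow, Padic.norm_p]
    norm_num
  have hz9 : ‖z‖ ≤ 1 / 9 := hρ.le
  -- §1: `L ≡ L₀ := z + a₁z²/2 + (a₁² + a₂)z³/3 (mod ‖z‖⁴ = 3⁻⁸)`
  set V := W.baseChange ℚ_[3] with hV
  set L := V.padicFormalLog z with hLdef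
  set L0 := z + (2 : ℚ_[3])⁻¹ * a₁ * z ^ 2 + (3 : ℚ_[3])⁻¹ * ((a₁ : ℚ_[3]) ^ 2 + a₂) * z ^ 3 with hL0
  have hLM : ‖L - L0‖ ≤ 1 / 6561 := by
    have h := norm_padicFormalLog_sub_cubic_le_deep V hz9; rw [ha1, ha2, hρ] at h; exact h.trans (by norm_num)
  have hL0z : ‖L0 - z‖ ≤ 1 / 81 := by
    rw [show L0 - z = (2 : ℚ_[3])⁻¹ * a₁ * z ^ 2 + (3 : ℚ_[3])⁻¹ * ((a₁ : ℚ_[3]) ^ 2 + a₂) * z ^ 3 by rw [hL0]; ring]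
    refine (IsUltrametricDist.norm_add_le_max _ _).trans (max_le ?_ ?_)
    · rw [norm_mul, norm_mul, norm_inv_two₁₀, one_mul, norm_pow, hρ]
      calc ‖(a₁ : ℚ_[3])‖ * (1 / 9) ^ 2 ≤ 1 * (1 / 9) ^ 2 := by gcongr
        _ = 1 / 81 := by norm_num
    · rw [norm_mul, norm_mul, norm_inv_three₁₀, norm_pow, hρ]
      calc 3 * ‖((a₁ : ℚ_[3]) ^ 2 + a₂)‖ * (1 / 9) ^ 3 ≤ 3 * 1 * (1 / 9) ^ 3 := by gcongr
        _ ≤ 1 / 81 := by norm_num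
  have hLz : ‖L - z‖ ≤ 1 / 81 := by
    rw [show L - z = (L - L0) + (L0 - z) by ring]
    exact (IsUltrametricDist.norm_add_le_max _ _).trans (max_le (hLM.trans (by norm_num)) hL0z)
  have hLn : ‖L‖ = 1 / 9 := by
    rw [← hρ]; refine Padic.norm_eq_of_norm_sub_lt_right (hLz.trans_lt ?_); rw [hρ]; norm_num
  have hL0n : ‖L0‖ = 1 / 9 := by
    rw [← hρ]; refine Padic.norm_eq_of_norm_sub_lt_right (hL0z.trans_lt ?_); rw [hρ]; norm_num
  -- `C² ≡ γ (mod 9)`, `w`, `ch w − 1`, the sigma product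
  have hC := norm_uniformisationScaleSq_sub_le W hc4 hc6 h3c6 hγ hq3
  set C2 := uniformisationScaleSq W 3 q with hC2
  have hCn : ‖C2‖ = 1 := by
    rw [← hγn]; exact Padic.norm_eq_of_norm_sub_lt_right (hC.trans_lt (by rw [hγn]; norm_num))
  have hC0 : C2 ≠ 0 := by intro h; rw [h, norm_zero] at hCn; exact zero_ne_one hCn
  have hwdef : logUnitParamSq W 3 q x y = L ^ 2 / C2 := by rw [logUnitParamSq, hx, hy, neg_div_cast_eq hb0 he0]
  set w := L ^ 2 / C2 with hw
  have hwn : ‖w‖ = 1 / 81 := by rw [hw, norm_div, norm_pow, hLn, hCn]; norm_num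
  have hw9 : ‖w‖ ≤ 1 / 9 := by rw [hwn]; norm_num
  have hw81 : ‖w‖ ≤ 1 / 81 := hwn.le
  have hCw : C2 * w = L ^ 2 := by rw [hw]; field_simp
  set c := coshOfSq w with hc
  have hcR : ‖c - (1 + w / 2 + w ^ 2 / 24 + w ^ 3 / 720)‖ ≤ 9 * ‖w‖ ^ 4 := by
    have := norm_coshOfSq_sub_cubic_le hw9; rwa [hc]
  have hc1 : ‖(c - 1) - w / 2‖ ≤ 3 * ‖w‖ ^ 2 := by have := norm_coshOfSq_sub_one_sub_half_le hw81; rwa [hc]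
  have hw2 : ‖w / 2‖ = 1 / 81 := by rw [norm_div, h2n, div_one, hwn]
  have hc1n : ‖c - 1‖ = 1 / 81 := by
    rw [← hw2]; refine Padic.norm_eq_of_norm_sub_lt_right (hc1.trans_lt ?_); rw [hw2, hwn]; norm_num
  have hcn : ‖c‖ ≤ 1 := by
    rw [show c = (c - 1) + 1 by ring]
    refine (IsUltrametricDist.norm_add_le_max _ _).trans (max_le ?_ (by rw [norm_one])); rw [hc1n]; norm_num
  have hPr := norm_tprod_tateSigmaSq_factor_sub_one_le hq hcn
  set Pr := ∏' n : ℕ, (1 - 2 * q ^ (n + 1) * c + q ^ (2 * (n + 1))) ^ 2 / (1 - q ^ (n + 1)) ^ 4 with hPrdef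
  have hσ : tateSigmaSq q c = 2 * (c - 1) * Pr := by rw [tateSigmaSq]
  -- `U = (γ(ae')²M² + 27(ae')⁴b²)/(4γb⁶)`, `81·U = L₀² + z⁴/(12γ)`
  set Dn : ℤ := 4 * γ * b ^ 6 with hDn
  set Nn : ℤ := γ * (a * e') ^ 2 * (2 * b ^ 2 - 9 * a₁ * (a * e') * b + 54 * (a₁ ^ 2 + a₂) * (a * e') ^ 2) ^ 2 +
    27 * (a * e') ^ 4 * b ^ 2 with hNn
  have hDnn : ‖(Dn : ℚ_[3])‖ = 1 := by
    rw [hDn]; push_cast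
    rw [norm_mul, norm_mul, norm_pow, hγn, hbn, show (4 : ℚ_[3]) = ((4 : ℤ) : ℚ_[3]) by norm_cast,
      norm_intCast_eq_one_of_not_dvd (by decide)]; norm_num
  have hDn0 : (Dn : ℚ_[3]) ≠ 0 := by intro h; rw [h, norm_zero] at hDnn; exact zero_ne_one hDnn
  set U : ℚ_[3] := (Nn : ℚ_[3]) / (Dn : ℚ_[3]) with hU
  have hPU : L0 ^ 2 + (12 : ℚ_[3])⁻¹ * ((γ : ℚ_[3]))⁻¹ * z ^ 4 = P * U := by
    have h12 : (2 : ℚ_[3]) ≠ 0 ∧ (3 : ℚ_[3]) ≠ 0 ∧ (12 : ℚ_[3]) ≠ 0 := by norm_num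
    rw [hU, hNn, hDn, hL0, hz, hP]; push_cast; field_simp; ring
  have hun : ‖(u : ℚ_[3])‖ = 1 := norm_intCast_eq_one_of_not_dvd h3u
  have hUu : ‖U - u‖ ≤ 1 / 81 := by
    have hid : U - u = ((((γ * (a * e') ^ 2 * (2 * b ^ 2 - 9 * a₁ * (a * e') * b + 54 * (a₁ ^ 2 + a₂) * (a * e') ^ 2) ^ 2 +
        27 * (a * e') ^ 4 * b ^ 2 - 4 * γ * u * b ^ 6 : ℤ)) : ℚ_[3])) / (Dn : ℚ_[3]) := by
      rw [hU, eq_div_iff hDn0, sub_mul, div_mul_cancel₀ _ hDn0, hNn, hDn]; push_cast; ring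
    rw [hid, norm_div, hDnn, div_one]
    exact (norm_intCast_le_of_pow_dvd (k := 4) (by norm_num; exact hu)).trans (by norm_num)
  have hUn : ‖U‖ = 1 := by
    rw [← hun]; exact Padic.norm_eq_of_norm_sub_lt_right (hUu.trans_lt (by rw [hun]; norm_num))
  have hU2 : ‖U ^ 2 - 1‖ ≤ 1 / 3 := by
    rw [show U ^ 2 - 1 = (U - u) * (U + u) + (((u ^ 2 - 1 : ℤ)) : ℚ_[3]) by push_cast; ring]
    refine (IsUltrametricDist.norm_add_le_max _ _).trans (max_le ?_ ?_)
    · rw [norm_mul]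
      have hUu' : ‖U + u‖ ≤ 1 := (IsUltrametricDist.norm_add_le_max _ _).trans (max_le hUn.le hun.le)
      calc ‖U - u‖ * ‖U + u‖ ≤ 1 / 81 * 1 := by gcongr
        _ ≤ 1 / 3 := by norm_num
    · exact (norm_intCast_le_of_pow_dvd (k := 1) (by rw [pow_one]; exact h3u2)).trans (by norm_num)
  -- `Y = C²σ² ≡ 81·U (mod 3⁻⁸)`
  have hY : ‖C2 * tateSigmaSq q c - P * U‖ ≤ ‖P‖ / 81 := by
    rw [hσ, ← hPU, hPn]
    have hsplit : C2 * (2 * (c - 1) * Pr) - (L0 ^ 2 + (12 : ℚ_[3])⁻¹ * ((γ : ℚ_[3]))⁻¹ * z ^ 4) =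
        (C2 * w - L ^ 2) * (1 + (C2 * w + L ^ 2) / (12 * C2)) +
        2 * C2 * (c - 1) * (Pr - 1) + 2 * C2 * (c - (1 + w / 2 + w ^ 2 / 24 + w ^ 3 / 720)) +
        C2 * w ^ 3 / 360 + (L - L0) * (L + L0) +
        (12 : ℚ_[3])⁻¹ * ((L ^ 2 - z ^ 2) * (L ^ 2 + z ^ 2) / C2 + z ^ 4 * ((γ : ℚ_[3]) - C2) / (C2 * γ)) := by
      have h12 : (12 : ℚ_[3]) ≠ 0 := by norm_num
      field_simp; ring
    rw [hsplit, hCw, sub_self, zero_mul, zero_add]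
    have hb1 : ‖2 * C2 * (c - 1) * (Pr - 1)‖ ≤ 1 / 81 / 81 := by
      rw [norm_mul, norm_mul, norm_mul, h2n, hCn, hc1n, one_mul, one_mul]
      calc 1 / 81 * ‖Pr - 1‖ ≤ 1 / 81 * (‖q‖ * ‖c - 1‖) := by gcongr
        _ ≤ 1 / 81 * (1 / 3 * (1 / 81)) := by rw [hc1n]; gcongr
        _ ≤ 1 / 81 / 81 := by norm_num
    have hb2 : ‖2 * C2 * (c - (1 + w / 2 + w ^ 2 / 24 + w ^ 3 / 720))‖ ≤ 1 / 81 / 81 := by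
      rw [norm_mul, norm_mul, h2n, hCn, one_mul, one_mul]; refine hcR.trans ?_; rw [hwn]; norm_num
    have hb3 : ‖C2 * w ^ 3 / 360‖ ≤ 1 / 81 / 81 := by
      have h360 : ‖(360 : ℚ_[3])‖ = 1 / 9 := by
        rw [show (360 : ℚ_[3]) = ((40 : ℤ) : ℚ_[3]) * (((3 : ℕ) : ℚ_[3]) ^ 2) by push_cast; norm_num, norm_mul,
          norm_pow, norm_intCast_eq_one_of_not_dvd (by decide), Padic.norm_p]; norm_num
      rw [norm_div, norm_mul, norm_pow, hCn, hwn, h360]; norm_num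
    have hb4 : ‖(L - L0) * (L + L0)‖ ≤ 1 / 81 / 81 := by
      rw [norm_mul]
      calc ‖L - L0‖ * ‖L + L0‖ ≤ 1 / 6561 * (1 / 9) := by
            gcongr; exact (IsUltrametricDist.norm_add_le_max _ _).trans (max_le hLn.le hL0n.le)
        _ ≤ 1 / 81 / 81 := by norm_num
    have hb5 : ‖(12 : ℚ_[3])⁻¹ * ((L ^ 2 - z ^ 2) * (L ^ 2 + z ^ 2) / C2 + z ^ 4 * ((γ : ℚ_[3]) - C2) / (C2 * γ))‖ ≤
        1 / 81 / 81 := by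
      rw [norm_mul, norm_inv_twelve₁₀]
      have h1 : ‖(L ^ 2 - z ^ 2) * (L ^ 2 + z ^ 2) / C2‖ ≤ 1 / 729 * (1 / 81) := by
        rw [norm_div, hCn, div_one, norm_mul, show L ^ 2 - z ^ 2 = (L - z) * (L + z) by ring, norm_mul]
        gcongr
        · calc ‖L - z‖ * ‖L + z‖ ≤ 1 / 81 * (1 / 9) := by
                gcongr; exact (IsUltrametricDist.norm_add_le_max _ _).trans (max_le hLn.le hρ.le)
            _ = 1 / 729 := by norm_num
        · refine (IsUltrametricDist.norm_add_le_max _ _).trans (max_le ?_ ?_) <;> rw [norm_pow]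
          · rw [hLn]; norm_num
          · rw [hρ]; norm_num
      have h2 : ‖z ^ 4 * ((γ : ℚ_[3]) - C2) / (C2 * γ)‖ ≤ (1 / 9) ^ 4 * (1 / 9) := by
        rw [norm_div, norm_mul, norm_mul, hCn, hγn, mul_one, div_one, norm_pow, hρ, ← norm_neg, neg_sub]; gcongr
      calc 3 * ‖(L ^ 2 - z ^ 2) * (L ^ 2 + z ^ 2) / C2 + z ^ 4 * ((γ : ℚ_[3]) - C2) / (C2 * γ)‖
          ≤ 3 * max (1 / 729 * (1 / 81)) ((1 / 9) ^ 4 * (1 / 9)) := by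
            gcongr; exact (IsUltrametricDist.norm_add_le_max _ _).trans (max_le_max h1 h2)
        _ ≤ 1 / 81 / 81 := by norm_num
    refine (IsUltrametricDist.norm_add_le_max _ _).trans (max_le ?_ hb5)
    refine (IsUltrametricDist.norm_add_le_max _ _).trans (max_le ?_ hb4)
    refine (IsUltrametricDist.norm_add_le_max _ _).trans (max_le ?_ hb3)
    exact (IsUltrametricDist.norm_add_le_max _ _).trans (max_le hb1 hb2)
  have hlogY := norm_padicLog_sub_le_deepO3 2 hUn hU2 hY
  -- the cubic polynomial at `U ≡ u (mod 81)`
  have hT0 : ‖1 - U ^ 2‖ ≤ 1 / 3 := by rw [← norm_neg, neg_sub]; exact hU2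
  have hT1 : ‖1 - (u : ℚ_[3]) ^ 2‖ ≤ 1 / 3 := by
    rw [show (1 : ℚ_[3]) - (u : ℚ_[3]) ^ 2 = -(((u ^ 2 - 1 : ℤ) : ℚ_[3])) by push_cast; ring, norm_neg]
    exact (norm_intCast_le_of_pow_dvd (k := 1) (by rw [pow_one]; exact h3u2)).trans (by norm_num)
  have hPoly : ‖((U ^ 2 - 1) - (U ^ 2 - 1) ^ 2 / 2 + (U ^ 2 - 1) ^ 3 / 3) -
      (((u : ℚ_[3]) ^ 2 - 1) - ((u : ℚ_[3]) ^ 2 - 1) ^ 2 / 2 + ((u : ℚ_[3]) ^ 2 - 1) ^ 3 / 3)‖ ≤ 1 / 81 := by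
    have hid : ((U ^ 2 - 1) - (U ^ 2 - 1) ^ 2 / 2 + (U ^ 2 - 1) ^ 3 / 3) -
        (((u : ℚ_[3]) ^ 2 - 1) - ((u : ℚ_[3]) ^ 2 - 1) ^ 2 / 2 + ((u : ℚ_[3]) ^ 2 - 1) ^ 3 / 3) =
        -(((1 - U ^ 2) + (1 - U ^ 2) ^ 2 / 2 + (1 - U ^ 2) ^ 3 / 3) -
          ((1 - (u : ℚ_[3]) ^ 2) + (1 - (u : ℚ_[3]) ^ 2) ^ 2 / 2 + (1 - (u : ℚ_[3]) ^ 2) ^ 3 / 3)) := by ring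
    rw [hid, norm_neg]
    refine (norm_cubicPoly_sub_le hT0 hT1).trans ?_
    rw [show (1 - U ^ 2) - (1 - (u : ℚ_[3]) ^ 2) = -((U - u) * (U + u)) by ring, norm_neg, norm_mul]
    have hUu' : ‖U + u‖ ≤ 1 := (IsUltrametricDist.norm_add_le_max _ _).trans (max_le hUn.le hun.le)
    calc ‖U - u‖ * ‖U + u‖ ≤ 1 / 81 * 1 := by gcongr
      _ = 1 / 81 := mul_one _
  -- `den x = 81e'²`
  have hden : x.den = (3 ^ 2 * e') ^ 2 := by
    have hpos : (0 : ℤ) < ((3 ^ 2 * e' : ℕ) : ℤ) ^ 2 := by positivity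
    have hcop2 : Nat.Coprime a.natAbs ((((3 ^ 2 * e' : ℕ) : ℤ) ^ 2).natAbs) := by
      rw [Int.natAbs_pow, Int.natAbs_natCast]; exact hcop.pow_right 2
    have h := Rat.den_div_eq_of_coprime hpos hcop2
    have hx' : x = ((a : ℤ) : ℚ) / ((((3 ^ 2 * e' : ℕ) : ℤ) ^ 2 : ℤ) : ℚ) := by rw [hx]; push_cast; ring
    rw [← hx'] at h
    exact_mod_cast h
  set Ud : ℚ_[3] := (e' : ℚ_[3]) ^ 2 with hUd
  have hUdn : ‖Ud‖ = 1 := by rw [hUd, norm_pow, he'n, one_pow]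
  have hUd2 : ‖Ud ^ 2 - 1‖ ≤ 1 / 3 := by
    rw [show Ud ^ 2 - 1 = ((((e' : ℤ) ^ 4 - 1 : ℤ)) : ℚ_[3]) by rw [hUd]; push_cast; ring]
    exact (norm_intCast_le_of_pow_dvd (k := 1) (by rw [pow_one]; exact three_dvd_pow_four_sub_one h3e')).trans
      (by norm_num)
  have hYd : ‖(((x.den : ℚ)) : ℚ_[3]) - P * Ud‖ ≤ ‖P‖ / 81 := by
    have : (((x.den : ℚ)) : ℚ_[3]) = P * Ud := by rw [hden, hP, hUd]; push_cast; ring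
    rw [this, sub_self, norm_zero]; positivity
  have hlogd := norm_padicLog_sub_le_deepO3 2 hUdn hUd2 hYd
  intro h0
  rw [heightFourOneCoord, hwdef] at h0
  have heq : padicLog 3 (((x.den : ℚ)) : ℚ_[3]) = padicLog 3 (C2 * tateSigmaSq q c) := sub_eq_zero.mp h0
  rw [heq] at hlogd
  set PU := (U ^ 2 - 1) - (U ^ 2 - 1) ^ 2 / 2 + (U ^ 2 - 1) ^ 3 / 3 with hPU'
  set Pu := ((u : ℚ_[3]) ^ 2 - 1) - ((u : ℚ_[3]) ^ 2 - 1) ^ 2 / 2 + ((u : ℚ_[3]) ^ 2 - 1) ^ 3 / 3 with hPu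
  set PE := (Ud ^ 2 - 1) - (Ud ^ 2 - 1) ^ 2 / 2 + (Ud ^ 2 - 1) ^ 3 / 3 with hPE
  have hdiff : ‖(2 : ℚ_[3])⁻¹ * PE - (2 : ℚ_[3])⁻¹ * Pu‖ ≤ 1 / 81 := by
    have : (2 : ℚ_[3])⁻¹ * PE - (2 : ℚ_[3])⁻¹ * Pu = ((padicLog 3 (C2 * tateSigmaSq q c) - (2 : ℚ_[3])⁻¹ * PU) -
        (padicLog 3 (C2 * tateSigmaSq q c) - (2 : ℚ_[3])⁻¹ * PE)) + (2 : ℚ_[3])⁻¹ * (PU - Pu) := by ring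
    rw [this]
    refine (IsUltrametricDist.norm_add_le_max _ _).trans
      (max_le ((norm_sub_le_max₁₀ _ _).trans (max_le hlogY hlogd)) ?_)
    rw [norm_mul, norm_inv_two₁₀, one_mul]; exact hPoly
  have hid : (2 : ℚ_[3])⁻¹ * PE - (2 : ℚ_[3])⁻¹ * Pu = (12 : ℚ_[3])⁻¹ *
      (((6 * ((e' : ℤ) ^ 4 - 1) - 3 * ((e' : ℤ) ^ 4 - 1) ^ 2 + 2 * ((e' : ℤ) ^ 4 - 1) ^ 3 -
        6 * (u ^ 2 - 1) + 3 * (u ^ 2 - 1) ^ 2 - 2 * (u ^ 2 - 1) ^ 3 : ℤ)) : ℚ_[3]) := by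
    have h12 : (2 : ℚ_[3]) ≠ 0 ∧ (3 : ℚ_[3]) ≠ 0 ∧ (12 : ℚ_[3]) ≠ 0 := by norm_num
    rw [hPE, hPu, hUd]; push_cast; field_simp; ring
  rw [hid, norm_mul, norm_inv_twelve₁₀] at hdiff
  have h81 : ((3 : ℕ) : ℤ) ^ 5 ∣ 6 * ((e' : ℤ) ^ 4 - 1) - 3 * ((e' : ℤ) ^ 4 - 1) ^ 2 + 2 * ((e' : ℤ) ^ 4 - 1) ^ 3 -
      6 * (u ^ 2 - 1) + 3 * (u ^ 2 - 1) ^ 2 - 2 * (u ^ 2 - 1) ^ 3 :=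
    (Padic.norm_int_le_pow_iff_dvd (p := 3) _ 5).mp (by
      have : ‖((((6 * ((e' : ℤ) ^ 4 - 1) - 3 * ((e' : ℤ) ^ 4 - 1) ^ 2 + 2 * ((e' : ℤ) ^ 4 - 1) ^ 3 -
          6 * (u ^ 2 - 1) + 3 * (u ^ 2 - 1) ^ 2 - 2 * (u ^ 2 - 1) ^ 3 : ℤ)) : ℚ_[3]))‖ ≤ 1 / 243 := by
        linarith only [hdiff]
      exact this.trans (by norm_num))
  exact hcert (by simpa using h81)

/-! ### §3 The bundled checker -/

/-- **`RegMult.CertNonsplit W 3 Q 1` from a THIRD-ORDER DEPTH-TWO REG3CERT certificate (`v₃(e(Q)) = 2`).** For the integer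
model `W = ⟨a₁,…,a₆⟩` (globally minimal, elliptic) and `Q = (a/e², b/e³)`, `e = 9e'`, the hypothesis `H` bundles the
row's integer facts (`c₄`, `c₆`, `3 ∤ c₆`, `9 ∣ c₄ + γc₆`, `3 ∤ γ`, `3 ∤ e'`, `3 ∤ b`, `gcd(a, e) = 1`, the gcd reduction
test, `81 ∣ γ(ae')²M² + 27(ae')⁴b² − 4γub⁶`, `3 ∤ u`, `3 ∣ u² − 1`, **`3⁵ ∤ 6E − 3E² + 2E³ − 6V + 3V² − 2V³`**), decided
per row by ONE `norm_num`; conclusion: admissibility of `Q` at `3` and `heightFourOneCoord W 3 q x y ≠ 0` for every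
`‖q‖₃ < 1` (`heightFourOneCoord_ne_zero_of_midCertO3`). Per curve; nothing class-wide.
[cite: SteinWuthrich2013, §4.2] [cite: MazurSteinTate2006, §1] [cite: SilvermanAEC2009, VII.3.4] -/
theorem certNonsplit_of_midCertO3 (W : WeierstrassCurve ℚ) {a₁ a₂ a₃ a₄ a₆ : ℤ} (hW : W = ⟨a₁, a₂, a₃, a₄, a₆⟩)
    [W.IsElliptic] [W.IsGloballyMinimal] {a b c4 c6 γ u : ℤ} {e' n : ℕ}
    (H : c4 = (a₁ ^ 2 + 4 * a₂) ^ 2 - 24 * (2 * a₄ + a₁ * a₃) ∧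
      c6 = -(a₁ ^ 2 + 4 * a₂) ^ 3 + 36 * (a₁ ^ 2 + 4 * a₂) * (2 * a₄ + a₁ * a₃) - 216 * (a₃ ^ 2 + 4 * a₆) ∧
      ¬ (3 : ℤ) ∣ c6 ∧ (9 : ℤ) ∣ c4 + γ * c6 ∧ ¬ (3 : ℤ) ∣ γ ∧ ¬ (3 : ℤ) ∣ e' ∧ ¬ (3 : ℤ) ∣ b ∧
      Nat.Coprime a.natAbs (3 ^ 2 * e') ∧
      Int.gcd (2 * b + a₁ * a * (3 ^ 2 * e' : ℕ) + a₃ * (3 ^ 2 * e' : ℕ) ^ 3)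
        (a₁ * b * (3 ^ 2 * e' : ℕ) - (3 * a ^ 2 + 2 * a₂ * a * (3 ^ 2 * e' : ℕ) ^ 2 + a₄ * (3 ^ 2 * e' : ℕ) ^ 4)) ∣
        (3 ^ 2 * e') ^ n ∧
      (81 : ℤ) ∣ γ * (a * e') ^ 2 * (2 * b ^ 2 - 9 * a₁ * (a * e') * b + 54 * (a₁ ^ 2 + a₂) * (a * e') ^ 2) ^ 2 +
        27 * (a * e') ^ 4 * b ^ 2 - 4 * γ * u * b ^ 6 ∧ ¬ (3 : ℤ) ∣ u ∧ (3 : ℤ) ∣ u ^ 2 - 1 ∧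
      ¬ (243 : ℤ) ∣ 6 * ((e' : ℤ) ^ 4 - 1) - 3 * ((e' : ℤ) ^ 4 - 1) ^ 2 + 2 * ((e' : ℤ) ^ 4 - 1) ^ 3 -
        6 * (u ^ 2 - 1) + 3 * (u ^ 2 - 1) ^ 2 - 2 * (u ^ 2 - 1) ^ 3)
    {x y : ℚ} (hx : x = a / ((3 ^ 2 * e' : ℕ) : ℚ) ^ 2) (hy : y = b / ((3 ^ 2 * e' : ℕ) : ℚ) ^ 3)
    (h : W.toAffine.Nonsingular x y) : RegMult.CertNonsplit W 3 (.some x y h) 1 := by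
  obtain ⟨hc4, hc6, h3c6, hγ, h3γ, h3e', h3b, hcop, hgcd, hu, h3u, h3u2, hcert⟩ := H
  have he'0 : e' ≠ 0 := by rintro rfl; exact h3e' (by simp)
  have he0 : (3 ^ 2 * e' : ℕ) ≠ 0 := by positivity
  have h3e : 3 ∣ 3 ^ 2 * e' := dvd_mul_of_dvd_left (dvd_pow_self 3 (by omega)) e'
  have hx1 : 1 < ‖(x : ℚ_[3])‖ := by
    haveI : Fact (Nat.Prime 3) := ⟨Nat.prime_three⟩
    exact (one_lt_norm_ratCast_iff 3 x).mpr (padicValRat_x_neg he0 hx hcop h3e)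
  have hadm : W.IsAdmissible 3 (.some x y h) :=
    isAdmissible_of_one_lt_norm (by norm_num) h hx1 (hasNonsingularReductionAt_of_gcd W hW he0 hx hy hcop hgcd)
  refine ⟨by rw [one_smul]; exact hadm, fun q _ hq1 _ => ?_⟩
  rw [one_smul]
  exact heightFourOneCoord_ne_zero_of_midCertO3 W (baseChange_a₁_eq W hW) (baseChange_a₂_eq W hW)
    (baseChange_c₄_eq W hW hc4) (baseChange_c₆_eq W hW hc6) h3c6 hγ h3γ h3e' h3b hcop hx hy hu h3u h3u2 hcert hq1

end Summit.BirchSwinnertonDyer.Rank1Residual.X11b.RegMult.KernelCert
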